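import Literature.Dynamics.Hyperbolic.CLPHyperbolicSetCalculus
import Literature.Dynamics.Hyperbolic.DichotomyWeightedSums
import Mathlib.Analysis.Calculus.MeanValue
import Mathlib.Topology.MetricSpace.Thickening

/-!
# Two-sided exponential tracking near a Chow–Lin–Palmer hyperbolic set

Topic `Literature/Dynamics/Hyperbolic`.  For a `C¹` self-map `ψ` of a real normed space and a set `T` carrying a
Chow–Lin–Palmer hyperbolic structure (`IsCLPHyperbolicSet ψ T P Q N λ Δ` of
`Literature/Dynamics/Hyperbolic/ChowLinPalmerShadowing.lean`: a `Dψ`-invariant splitting `E = S(x) ⊕ U(x)` along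
`T` with `m`-step contraction `‖D(ψ^m)(x) P(x)‖ ≤ Nλ^m` on `S` and `m`-step expansion on `U`,
`D(ψ^m)(x) : U(x) → U(ψ^m x)` bijective — NO invertibility of `ψ` or of `Dψ` is assumed), every finite orbit
segment `x_0,…,x_n` of `ψ` that stays within a small distance `ρ` of an orbit segment `y_0,…,y_n ⊆ T` is
TWO-SIDED EXPONENTIALLY close to it:

`‖x_i − y_i‖ ≤ 2N (θ^i ‖x_0 − y_0‖ + θ^{n-i} ‖x_n − y_n‖)`, `0 ≤ i ≤ n`, for any `θ ∈ (λ, 1)`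

(`TracksWith`, `IsCLPHyperbolicSet.tracksWith`, `IsCLPHyperbolicSet.exists_tracksWith`).  This is the discrete
"exponential dichotomy / hyperbolic neighbourhood" estimate behind the λ-lemma and behind the PHASE CONTROL of
shadowing orbits near a transversal homoclinic loop: with `y ≡ p₀` a hyperbolic fixed point it is the classical
two-sided estimate for orbit segments near `p₀` (exponential convergence of homoclinic crossings, uniform-in-dwell
control of return-time drift), with `y` the homoclinic orbit it controls shadows along the excursion (the step the
Navier–Stokes line `homoclinic-excursion-trains` of `Summits/AnomalousDissipation` needs between the
Chow–Lin–Palmer shadowing lemma and equal-time closeness of its trains).  Also: `IsCLPHyperbolicSet.mono`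
(restriction of a CLP structure to a positively invariant subset, e.g. `{p₀} ⊆ Λ`).

Proof (standard dichotomy estimates, e.g. Pilyugin, LNM 1706 (1999) §1.3, Palmer, *Shadowing in Dynamical
Systems* (2000) Ch. 2–3; written here for non-invertible maps): with `e_k = x_k − y_k`,
`e_{k+1} = A_k e_k + R_k`, `A_k = Dψ(y_k)`, `‖R_k‖ ≤ η‖e_k‖` (mean value inequality + UNIFORM continuity of `Dψ`
on the `Δ`-neighbourhood of `T`, condition (5); `η → 0` with `ρ`); the stable components `s_k = P(y_k) e_k`
satisfy `s_k = Φ(k,0) s_0 + Σ_{j<k} Φ(k,j+1) P(y_{j+1}) R_j` with the transition operators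
`Φ(k,j) = D(ψ^{k-j})(y_j)`; the unstable components are solved BACKWARD from `k = n` through the bijections
`Φ(n,k) : U(y_k) → U(y_n)` and their `m`-step bounds (no inverse operators are formed: the unique preimages and
their norms come from (1.88)); the resulting scalar inequality
`a_k ≤ N(λ^k a_0 + λ^{n-k} a_n) + Nη(Σ_{j<k} λ^{k-1-j} a_j + Σ_{k≤j<n} λ^{j+1-k} a_j)`
is closed by a weighted-maximum argument with weights `θ^k α + θ^{n-k} β` once `NηK ≤ 1/2`,
`K = 1/(θ-λ) + 1/(1-λθ)`.

References: S. Yu. Pilyugin, *Shadowing in Dynamical Systems*, LNM 1706 (1999), §1.3 [Pilyugin1999];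
K. J. Palmer, *Shadowing in Dynamical Systems. Theory and Applications*, Kluwer (2000), Ch. 2–3.
-/

noncomputable section

open Set Function Metric
open scoped Topology

namespace Literature.Dynamics.Hyperbolic

variable {E : Type*} [NormedAddCommGroup E] [NormedSpace ℝ E]

/-! ## The tracking property -/

/-- **Two-sided exponential tracking with constants `(ρ, C, θ)`** for the map `ψ` along the set `T`: every finite
orbit segment `x₀,…,x_n` of `ψ` that stays within `ρ` of an orbit segment `y₀,…,y_n ⊆ T` satisfies
`‖x_i − y_i‖ ≤ C (θ^i ‖x₀ − y₀‖ + θ^{n−i} ‖x_n − y_n‖)` for `0 ≤ i ≤ n`. [folklore] -/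
def TracksWith (ψ : E → E) (T : Set E) (ρ C θ : ℝ) : Prop :=
  ∀ (n : ℕ) (x y : ℕ → E), (∀ i, i ≤ n → y i ∈ T) → (∀ i, i < n → ψ (y i) = y (i + 1)) →
    (∀ i, i < n → ψ (x i) = x (i + 1)) → (∀ i, i ≤ n → ‖x i - y i‖ ≤ ρ) →
      ∀ i, i ≤ n → ‖x i - y i‖ ≤ C * (θ ^ i * ‖x 0 - y 0‖ + θ ^ (n - i) * ‖x n - y n‖)

/-! ## The dichotomy estimates along an orbit segment -/

section Estimates

open Finset

variable {ψ : E → E} {T : Set E} {P Q : E → E →L[ℝ] E} {N lam Δ : ℝ}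

omit [NormedAddCommGroup E] [NormedSpace ℝ E] in
/-- `ψ^[m] (y 0) = y m` along an orbit segment. [folklore] -/
theorem iterate_orbit_zero {y : ℕ → E} {n : ℕ} (hy : ∀ i, i < n → ψ (y i) = y (i + 1)) {m : ℕ}
    (hm : m ≤ n) : ψ^[m] (y 0) = y m := by
  have := iterate_orbit hy (j := 0) (m := m) (by omega)
  simpa only [Nat.zero_add] using this

/-- **STABLE ESTIMATE.**  Along an orbit segment `y_0,…,y_n ⊆ T`, if `e_k = x_k − y_k` has linearisation
remainders `‖e_{k+1} − Dψ(y_k) e_k‖ ≤ η ‖e_k‖`, then the stable components obey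
`‖P(y_k) e_k‖ ≤ Nλ^k ‖e_0‖ + Nη Σ_{j<k} λ^{k-1-j} ‖e_j‖`. [folklore] -/
theorem IsCLPHyperbolicSet.norm_stable_le (h : IsCLPHyperbolicSet ψ T P Q N lam Δ) {n : ℕ} {x y : ℕ → E}
    {η : ℝ} (hyT : ∀ i, i ≤ n → y i ∈ T) (hy : ∀ i, i < n → ψ (y i) = y (i + 1))
    (hR : ∀ k, k < n → ‖(x (k + 1) - y (k + 1)) - fderiv ℝ ψ (y k) (x k - y k)‖ ≤ η * ‖x k - y k‖)
    {k : ℕ} (hk : k ≤ n) :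
    ‖P (y k) (x k - y k)‖ ≤
      N * lam ^ k * ‖x 0 - y 0‖ + N * η * ∑ j ∈ range k, lam ^ (k - 1 - j) * ‖x j - y j‖ := by
  -- notation
  set e : ℕ → E := fun k => x k - y k with he
  set R : ℕ → E := fun k => e (k + 1) - fderiv ℝ ψ (y k) (e k) with hRdef
  -- the forcing terms of the closed form
  set term : ℕ → ℕ → E := fun k j => fderiv ℝ (ψ^[k - 1 - j]) (y (j + 1)) (P (y (j + 1)) (R j))
    with hterm
  -- CLOSED FORM: `P(y_k) e_k = D(ψ^k)(y_0) P(y_0) e_0 + Σ_{j<k} D(ψ^{k-1-j})(y_{j+1}) P(y_{j+1}) R_j`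
  have closed : ∀ k, k ≤ n →
      P (y k) (e k) = fderiv ℝ (ψ^[k]) (y 0) (P (y 0) (e 0)) + ∑ j ∈ range k, term k j := by
    intro k
    induction k with
    | zero =>
      intro _
      simp only [Function.iterate_zero, fderiv_id, ContinuousLinearMap.coe_id', id_eq, Finset.range_zero,
        Finset.sum_empty, add_zero]
    | succ k ih =>
      intro hk1
      have hk : k ≤ n := (Nat.le_succ k).trans hk1
      have hkn : k < n := hk1
      have hyk : y k ∈ T := hyT k hk
      -- split `e (k+1) = Dψ(y k) e_k + R_k` and `e_k = s_k + u_k`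
      have hsplit : e (k + 1) =
          fderiv ℝ ψ (y k) (P (y k) (e k)) + fderiv ℝ ψ (y k) (Q (y k) (e k)) + R k := by
        have h1 : e (k + 1) = fderiv ℝ ψ (y k) (e k) + R k := by simp only [hRdef]; abel
        conv_lhs => rw [h1, ← h.P_add_Q_apply hyk (e k)]
        rw [map_add]
      have hs_mem : fderiv ℝ ψ (y k) (P (y k) (e k)) ∈ range (P (y (k + 1))) := by
        rw [← hy k hkn]
        exact h.mapsTo_stable (y k) hyk (mem_range_self _)
      have hu_mem : fderiv ℝ ψ (y k) (Q (y k) (e k)) ∈ range (Q (y (k + 1))) := by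
        rw [← hy k hkn]
        exact (h.bijOn_unstable (y k) hyk).mapsTo (mem_range_self _)
      have hyk1 : y (k + 1) ∈ T := hyT (k + 1) hk1
      rw [hsplit, map_add, map_add, h.P_apply_of_mem hyk1 hs_mem, h.P_apply_of_mem_Q hyk1 hu_mem, add_zero,
        ih hk, map_add]
      -- `Dψ(y k) ∘ D(ψ^k)(y 0) = D(ψ^{k+1})(y 0)`
      have hcomp : fderiv ℝ ψ (y k) (fderiv ℝ (ψ^[k]) (y 0) (P (y 0) (e 0))) =
          fderiv ℝ (ψ^[k + 1]) (y 0) (P (y 0) (e 0)) := by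
        rw [h.fderiv_iterate_succ k (y 0), iterate_orbit_zero hy hk]
        rfl
      -- `Dψ(y k) term k j = term (k+1) j` for `j < k`, and `term (k+1) k = P(y_{k+1}) R_k`
      have hterms : fderiv ℝ ψ (y k) (∑ j ∈ range k, term k j) + P (y (k + 1)) (R k) =
          ∑ j ∈ range (k + 1), term (k + 1) j := by
        rw [Finset.sum_range_succ, map_sum]
        congr 1
        · refine Finset.sum_congr rfl fun j hj => ?_
          have hjk : j < k := Finset.mem_range.1 hj
          simp only [hterm]
          have e1 : k + 1 - 1 - j = (k - 1 - j) + 1 := by omega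
          rw [e1, h.fderiv_iterate_succ (k - 1 - j) (y (j + 1)),
            iterate_orbit hy (j := j + 1) (m := k - 1 - j) (by omega)]
          have e2 : j + 1 + (k - 1 - j) = k := by omega
          rw [e2]
          rfl
        · simp only [hterm, Nat.add_sub_cancel, Nat.sub_self, Function.iterate_zero, fderiv_id,
            ContinuousLinearMap.coe_id', id_eq]
      rw [hcomp, add_assoc, hterms]
  -- THE BOUND
  have hclosed := closed k hk
  have hterm_le : ∀ j ∈ range k, ‖term k j‖ ≤ N * η * (lam ^ (k - 1 - j) * ‖e j‖) := by
    intro j hj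
    have hjk : j < k := Finset.mem_range.1 hj
    have hjn : j < n := lt_of_lt_of_le hjk hk
    have hyj : y (j + 1) ∈ T := hyT (j + 1) (by omega)
    calc ‖term k j‖ ≤ N * lam ^ (k - 1 - j) * ‖R j‖ := h.norm_fderiv_iterate_P_le hyj _ _
      _ ≤ N * lam ^ (k - 1 - j) * (η * ‖e j‖) := by
          gcongr
          · exact mul_nonneg h.N_pos.le (pow_nonneg h.lam_pos.le _)
          · exact hR j hjn
      _ = N * η * (lam ^ (k - 1 - j) * ‖e j‖) := by ring
  calc ‖P (y k) (e k)‖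
      = ‖fderiv ℝ (ψ^[k]) (y 0) (P (y 0) (e 0)) + ∑ j ∈ range k, term k j‖ := by rw [hclosed]
    _ ≤ ‖fderiv ℝ (ψ^[k]) (y 0) (P (y 0) (e 0))‖ + ∑ j ∈ range k, ‖term k j‖ :=
        (norm_add_le _ _).trans (add_le_add le_rfl (norm_sum_le _ _))
    _ ≤ N * lam ^ k * ‖e 0‖ + ∑ j ∈ range k, N * η * (lam ^ (k - 1 - j) * ‖e j‖) :=
        add_le_add (h.norm_fderiv_iterate_P_le (hyT 0 (Nat.zero_le n)) k (e 0))
          (Finset.sum_le_sum hterm_le)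
    _ = N * lam ^ k * ‖e 0‖ + N * η * ∑ j ∈ range k, lam ^ (k - 1 - j) * ‖e j‖ := by
        rw [Finset.mul_sum]

/-- **UNSTABLE ESTIMATE.**  In the same situation the unstable components, solved BACKWARD from `k = n` through
the bijections `D(ψ^m)(y_k) : U(y_k) → U(y_{k+m})` and their `m`-step bounds, obey
`‖Q(y_k) e_k‖ ≤ Nλ^{n-k} ‖e_n‖ + Nη Σ_{k≤j<n} λ^{j+1-k} ‖e_j‖`. [folklore] -/
theorem IsCLPHyperbolicSet.norm_unstable_le (h : IsCLPHyperbolicSet ψ T P Q N lam Δ) {n : ℕ} {x y : ℕ → E}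
    {η : ℝ} (hyT : ∀ i, i ≤ n → y i ∈ T) (hy : ∀ i, i < n → ψ (y i) = y (i + 1))
    (hR : ∀ k, k < n → ‖(x (k + 1) - y (k + 1)) - fderiv ℝ ψ (y k) (x k - y k)‖ ≤ η * ‖x k - y k‖)
    {k : ℕ} (hk : k ≤ n) :
    ‖Q (y k) (x k - y k)‖ ≤
      N * lam ^ (n - k) * ‖x n - y n‖ + N * η * ∑ j ∈ Ico k n, lam ^ (j + 1 - k) * ‖x j - y j‖ := by
  set e : ℕ → E := fun k => x k - y k with he
  set R : ℕ → E := fun k => e (k + 1) - fderiv ℝ ψ (y k) (e k) with hRdef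
  -- one-step unstable recursion: `Dψ(y k) Q(y k) e_k = Q(y_{k+1}) e_{k+1} − Q(y_{k+1}) R_k`
  have hstep : ∀ k, k < n →
      fderiv ℝ ψ (y k) (Q (y k) (e k)) = Q (y (k + 1)) (e (k + 1)) - Q (y (k + 1)) (R k) := by
    intro k hkn
    have hyk : y k ∈ T := hyT k hkn.le
    have hyk1 : y (k + 1) ∈ T := hyT (k + 1) hkn
    have h1 : e (k + 1) =
        fderiv ℝ ψ (y k) (P (y k) (e k)) + fderiv ℝ ψ (y k) (Q (y k) (e k)) + R k := by
      have h0 : e (k + 1) = fderiv ℝ ψ (y k) (e k) + R k := by simp only [hRdef]; abel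
      conv_lhs => rw [h0, ← h.P_add_Q_apply hyk (e k)]
      rw [map_add]
    have hs_mem : fderiv ℝ ψ (y k) (P (y k) (e k)) ∈ range (P (y (k + 1))) := by
      rw [← hy k hkn]; exact h.mapsTo_stable (y k) hyk (mem_range_self _)
    have hu_mem : fderiv ℝ ψ (y k) (Q (y k) (e k)) ∈ range (Q (y (k + 1))) := by
      rw [← hy k hkn]; exact (h.bijOn_unstable (y k) hyk).mapsTo (mem_range_self _)
    have h2 : Q (y (k + 1)) (e (k + 1)) = fderiv ℝ ψ (y k) (Q (y k) (e k)) + Q (y (k + 1)) (R k) := by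
      rw [h1, map_add, map_add, h.Q_apply_of_mem_P hyk1 hs_mem, h.Q_apply_of_mem_Q hyk1 hu_mem, zero_add]
    rw [h2]; abel
  -- forcing terms of the backward identity (`m` = end index)
  set term : ℕ → ℕ → E := fun m j => fderiv ℝ (ψ^[m - 1 - j]) (y (j + 1)) (Q (y (j + 1)) (R j))
    with hterm
  -- BACKWARD IDENTITY: `D(ψ^i)(y_k) Q(y_k) e_k = Q(y_{k+i}) e_{k+i} − Σ_{k≤j<k+i} term (k+i) j`
  have backward : ∀ i k, k + i ≤ n →
      fderiv ℝ (ψ^[i]) (y k) (Q (y k) (e k)) =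
        Q (y (k + i)) (e (k + i)) - ∑ j ∈ Ico k (k + i), term (k + i) j := by
    intro i
    induction i with
    | zero =>
      intro k _
      simp only [Function.iterate_zero, fderiv_id, ContinuousLinearMap.coe_id', id_eq, Nat.add_zero,
        Finset.Ico_self, Finset.sum_empty, sub_zero]
    | succ i ih =>
      intro k hki
      have hkn : k < n := by omega
      have hchain : fderiv ℝ (ψ^[i + 1]) (y k) =
          (fderiv ℝ (ψ^[i]) (y (k + 1))).comp (fderiv ℝ ψ (y k)) := by
        rw [h.fderiv_iterate_add i 1 (y k), Function.iterate_one, hy k hkn]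
      rw [hchain, ContinuousLinearMap.coe_comp, Function.comp_apply, hstep k hkn, map_sub,
        ih (k + 1) (by omega)]
      have e1 : k + 1 + i = k + (i + 1) := by omega
      rw [e1, Finset.sum_eq_sum_Ico_succ_bot (show k < k + (i + 1) by omega)]
      have e2 : term (k + (i + 1)) k = fderiv ℝ (ψ^[i]) (y (k + 1)) (Q (y (k + 1)) (R k)) := by
        simp only [hterm]
        have : k + (i + 1) - 1 - k = i := by omega
        rw [this]
      rw [e2]
      abel
  -- SOLVES at the index `k`
  have hyk : y k ∈ T := hyT k hk
  obtain ⟨z, hz_mem, hz_eq, hz_le⟩ := h.exists_unstable_solve hyk (n - k) (e n)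
  have hiter : ψ^[n - k] (y k) = y n := by
    rw [iterate_orbit hy (j := k) (m := n - k) (by omega)]; congr 1; omega
  rw [hiter] at hz_eq
  have hw : ∀ j : ℕ, ∃ w ∈ range (Q (y k)), fderiv ℝ (ψ^[j + 1 - k]) (y k) w = Q (ψ^[j + 1 - k] (y k)) (R j) ∧
      ‖w‖ ≤ N * lam ^ (j + 1 - k) * ‖R j‖ := fun j => h.exists_unstable_solve hyk (j + 1 - k) (R j)
  choose w hw_mem hw_eq hw_le using hw
  -- `D(ψ^{n-k})(y_k) (z − Σ w_j) = D(ψ^{n-k})(y_k) Q(y_k) e_k`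
  have hident : fderiv ℝ (ψ^[n - k]) (y k) (z - ∑ j ∈ Ico k n, w j) =
      fderiv ℝ (ψ^[n - k]) (y k) (Q (y k) (e k)) := by
    rw [map_sub, map_sum, hz_eq, backward (n - k) k (by omega)]
    have e1 : k + (n - k) = n := by omega
    rw [e1]
    congr 1
    refine Finset.sum_congr rfl fun j hj => ?_
    obtain ⟨hkj, hjn⟩ := Finset.mem_Ico.1 hj
    have e2 : n - k = (n - 1 - j) + (j + 1 - k) := by omega
    rw [e2, h.fderiv_iterate_add (n - 1 - j) (j + 1 - k) (y k), ContinuousLinearMap.coe_comp,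
      Function.comp_apply, hw_eq j]
    have e3 : ψ^[j + 1 - k] (y k) = y (j + 1) := by
      rw [iterate_orbit hy (j := k) (m := j + 1 - k) (by omega)]; congr 1; omega
    rw [e3]
  -- both sides lie in `U(y_k)`, on which `D(ψ^{n-k})(y_k)` is injective
  have hmem1 : Q (y k) (e k) ∈ range (Q (y k)) := mem_range_self _
  have hmem2 : z - ∑ j ∈ Ico k n, w j ∈ range (Q (y k)) :=
    sub_mem_range_clm _ hz_mem (sum_mem_range_clm _ _ _ fun j _ => hw_mem j)
  have hueq : Q (y k) (e k) = z - ∑ j ∈ Ico k n, w j :=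
    (h.bijOn_unstable_iterate hyk (n - k)).injOn hmem1 hmem2 hident.symm
  -- THE BOUND
  have hw_le' : ∀ j ∈ Finset.Ico k n, ‖w j‖ ≤ N * η * (lam ^ (j + 1 - k) * ‖e j‖) := by
    intro j hj
    obtain ⟨hkj, hjn⟩ := Finset.mem_Ico.1 hj
    calc ‖w j‖ ≤ N * lam ^ (j + 1 - k) * ‖R j‖ := hw_le j
      _ ≤ N * lam ^ (j + 1 - k) * (η * ‖e j‖) := by
          gcongr
          · exact mul_nonneg h.N_pos.le (pow_nonneg h.lam_pos.le _)
          · exact hR j hjn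
      _ = N * η * (lam ^ (j + 1 - k) * ‖e j‖) := by ring
  calc ‖Q (y k) (e k)‖ = ‖z - ∑ j ∈ Ico k n, w j‖ := by rw [hueq]
    _ ≤ ‖z‖ + ∑ j ∈ Ico k n, ‖w j‖ := (norm_sub_le _ _).trans (add_le_add le_rfl (norm_sum_le _ _))
    _ ≤ N * lam ^ (n - k) * ‖e n‖ + ∑ j ∈ Ico k n, N * η * (lam ^ (j + 1 - k) * ‖e j‖) :=
        add_le_add hz_le (Finset.sum_le_sum hw_le')
    _ = N * lam ^ (n - k) * ‖e n‖ + N * η * ∑ j ∈ Ico k n, lam ^ (j + 1 - k) * ‖e j‖ := by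
        rw [Finset.mul_sum]

end Estimates

/-! ## The tracking theorem -/

section Main

open Finset

variable {ψ : E → E} {T : Set E} {P Q : E → E →L[ℝ] E} {N lam Δ : ℝ}

/-- **TWO-SIDED EXPONENTIAL TRACKING near a Chow–Lin–Palmer hyperbolic set**, with explicit constants: for every
rate `θ ∈ (λ, 1)` there is `ρ ∈ (0, Δ]` such that every orbit segment staying within `ρ` of an orbit segment in `T`
satisfies `‖x_i − y_i‖ ≤ 2N (θ^i ‖x_0 − y_0‖ + θ^{n-i} ‖x_n − y_n‖)`. [folklore] -/
theorem IsCLPHyperbolicSet.tracksWith (h : IsCLPHyperbolicSet ψ T P Q N lam Δ) {θ : ℝ} (hθ : lam < θ)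
    (hθ1 : θ < 1) : ∃ ρ : ℝ, 0 < ρ ∧ ρ ≤ Δ ∧ TracksWith ψ T ρ (2 * N) θ := by
  have hN := h.N_pos
  have hlam := h.lam_pos
  have hd1 : 0 < θ - lam := sub_pos.2 hθ
  have hlt : lam * θ < 1 := by nlinarith
  have hd2 : 0 < 1 - lam * θ := sub_pos.2 hlt
  set K : ℝ := 1 / (θ - lam) + 1 / (1 - lam * θ) with hK
  have hKpos : 0 < K := by positivity
  set η : ℝ := 1 / (2 * N * K) with hη
  have hη0 : 0 < η := by positivity
  have hηK : N * η * K ≤ 1 / 2 := by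
    have : N * η * K = 1 / 2 := by
      simp only [hη]; field_simp
    exact this.le
  -- uniform continuity of `Dψ` on the closed `Δ`-neighbourhood of `T`
  obtain ⟨δu, hδu, hunif⟩ := Metric.uniformContinuousOn_iff.1 h.uniformContinuousOn_fderiv η hη0
  set ρ : ℝ := min (δu / 2) Δ with hρ
  have hρ0 : 0 < ρ := lt_min (by linarith) h.Δ_pos
  refine ⟨ρ, hρ0, min_le_right _ _, ?_⟩
  intro n x y hyT hy hx hclose
  -- linearisation remainders: `‖e_{k+1} − Dψ(y_k) e_k‖ ≤ η ‖e_k‖`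
  have hR : ∀ k, k < n → ‖(x (k + 1) - y (k + 1)) - fderiv ℝ ψ (y k) (x k - y k)‖ ≤ η * ‖x k - y k‖ := by
    intro k hkn
    have hyk : y k ∈ T := hyT k hkn.le
    rw [← hx k hkn, ← hy k hkn]
    have hball : ∀ w ∈ closedBall (y k) ρ, ‖fderiv ℝ ψ w - fderiv ℝ ψ (y k)‖ ≤ η := by
      intro w hw
      have hwd : dist w (y k) ≤ ρ := mem_closedBall.1 hw
      have hwc : w ∈ cthickening Δ T :=
        Metric.mem_cthickening_of_dist_le w (y k) Δ T hyk (hwd.trans (min_le_right _ _))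
      have hyc : y k ∈ cthickening Δ T := self_subset_cthickening T hyk
      have hdist : dist w (y k) < δu :=
        lt_of_le_of_lt (hwd.trans (min_le_left _ _)) (half_lt_self hδu)
      have := hunif w hwc (y k) hyc hdist
      rw [dist_eq_norm] at this
      exact this.le
    have hdiff : ∀ w ∈ closedBall (y k) ρ, DifferentiableAt ℝ ψ w := fun w _ =>
      (h.contDiff.differentiable one_ne_zero) w
    exact (convex_closedBall (y k) ρ).norm_image_sub_le_of_norm_fderiv_le' hdiff hball
      (mem_closedBall_self hρ0.le) (mem_closedBall_iff_norm.2 (hclose k hkn.le))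
  -- the scalar two-sided inequality
  have hineq : ∀ k, k ≤ n → ‖x k - y k‖ ≤
      N * lam ^ k * ‖x 0 - y 0‖ + N * lam ^ (n - k) * ‖x n - y n‖ +
        N * η * (∑ j ∈ Finset.range k, lam ^ (k - 1 - j) * ‖x j - y j‖ +
          ∑ j ∈ Finset.Ico k n, lam ^ (j + 1 - k) * ‖x j - y j‖) := by
    intro k hk
    have hs := h.norm_stable_le hyT hy hR hk
    have hu := h.norm_unstable_le hyT hy hR hk
    have hsplit : ‖x k - y k‖ ≤ ‖P (y k) (x k - y k)‖ + ‖Q (y k) (x k - y k)‖ := by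
      conv_lhs => rw [← h.P_add_Q_apply (hyT k hk) (x k - y k)]
      exact norm_add_le _ _
    linarith
  exact two_sided_bound_of_ineq hN hlam.le hθ hθ1 (fun k => norm_nonneg _) hη0.le hηK hineq

/-- **Existence form** (the statement consumed downstream): a Chow–Lin–Palmer hyperbolic set admits tracking
constants `ρ ∈ (0, Δ]`, `C > 0`, `θ ∈ (0, 1)`. [folklore] -/
theorem IsCLPHyperbolicSet.exists_tracksWith (h : IsCLPHyperbolicSet ψ T P Q N lam Δ) :
    ∃ ρ : ℝ, 0 < ρ ∧ ρ ≤ Δ ∧ ∃ C : ℝ, 0 < C ∧ ∃ θ : ℝ, 0 < θ ∧ θ < 1 ∧ TracksWith ψ T ρ C θ := by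
  have hlam := h.lam_pos
  have hlam1 := h.lam_lt_one
  obtain ⟨ρ, hρ, hρΔ, htr⟩ := h.tracksWith (θ := (lam + 1) / 2) (by linarith) (by linarith)
  exact ⟨ρ, hρ, hρΔ, 2 * N, by have := h.N_pos; positivity, (lam + 1) / 2, by linarith, by linarith, htr⟩

end Main

end Literature.Dynamics.Hyperbolic

end
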